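import Summits.QuantumFields.BalabanUV.T4Continuum.Support.AveragingDeficitCovGrad
import Summits.QuantumFields.BalabanUV.T4Continuum.Support.BlockAveragePushDirGauge
import Summits.QuantumFields.BalabanUV.T4Continuum.Support.AveragingDeficitHSInner
import HarnessLib

/-!
# T⁴ programme, node NE3 — route H♮ (ruling ρ-g22-2), row K6 input K6-cg: THE DRESSED CURL OF A LINEARISED GAUGE DIRECTION IS THE
# PLAQUETTE COMMUTATOR — `curlAt W (gaugeDir W ζ) z μ ν = ζ z − Ad_{W(∂p)} (ζ z)`, hence `curlSq W (gaugeDir W ζ) F ≤ 4a²·#planes·Σ_{z∈F}‖ζ z‖²`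

NE3 (node U1b), row NE3 OWNER `b2b-balaban-t4-ne3-p1` (gen 23); the (S5) input of the K6 ASSEMBLY BLUEPRINT (RULING ρ-g23-3, journal
l.19107; memo `HOME/t4/b2b-balaban-t4-ne3-p1/g23/D-ne3p1-g23-1.md` §1 (S5)): after the spectral cut `Y = η′ + gaugeDir W ζ′`, the curl
of `η′` is the curl of `Y` up to the curl of a pure-gauge direction, and the latter is NOT zero at a curved background but the commutator of
the gauge parameter with the plaquette variable — first order in the plaquette radius `a`, undifferenced in `ζ′` (this is where `ζ′`'s
spectral size `(M∕ε)‖Y‖` meets `a`, giving the budget term `8d²(θ∕ε)²M^{−2}·y²`).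

CONTENT (all [folklore]; 0 sorry; 0 def):
§1 **`curlAt_gaugeDir`** — for EVERY group-valued `W` and every site field `ζ`:
   `curlAt W (gaugeDir W ζ) z μ ν = ζ z − Ad (hol W z (plaqWord μ ν)) (ζ z)` (the four transported differences telescope around `∂p`);
   `curlAt_gaugeDir_self` (`μ = ν`: zero);
§2 sizes at a unitary `W` with `‖W(∂p) − 1‖ ≤ a` on the plane `μ ≠ ν` (`SmallField W a`): op-norm `‖curlAt W (gaugeDir W ζ) z μ ν‖ ≤ 2a·‖ζ z‖`,
   nhs `nhsNorm (…) ≤ 2a·nhsNorm (ζ z)` and `nhsNormSq (…) ≤ 4a²·nhsNormSq (ζ z)`;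
§3 linearity of the dressed curl in the direction field (`curlAt_sub`) and the two-term split `‖curlAt V (ψ − φ)‖² ≤ 2‖curlAt V ψ‖² + 2‖curlAt V φ‖²`;
§4 **`curlSq_gaugeDir_le`**: `curlSq W (gaugeDir W ζ) F ≤ 4a²·(Fintype.card (Plane d))·Σ_{z∈F} ‖ζ z‖²` and
   **`curlSq_sub_gaugeDir_le`**: `curlSq W (Y − gaugeDir W ζ) F ≤ 2·curlSq W Y F + 8a²·(Fintype.card (Plane d))·Σ_{z∈F}‖ζ z‖²`
   (the form (S5) consumes, op-norm currency = the currency of `SlicePoincare`'s `curlSq`).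

HONEST FRAMING.  Elementary lattice gauge calculus on OUR typed objects (context only: [Balaban1985Averaging] (44)–(45) p. 24, gauge covariance of
plaquette variables); nothing about Bałaban's minimisers; (P♮)_W, (ML_w) at W ≠ 1, T-E_w and NE3 are NOT proved; spine PROVED 0∕9; finite T⁴
rung (B)+1 — NOT infinite volume, NOT mass gap, NOT BetaPertH, NOT Clay.  PLACEMENT: `Summits/QuantumFields/BalabanUV/`; imports accepted modules only.
-/

set_option autoImplicit false

open scoped BigOperators Matrix.Norms.L2Operator
open Finset

namespace Summit.QuantumFields.BalabanUV.T4Continuum.NE3CurlOfGaugeDir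

open Literature.MathematicalPhysics.QuantumFieldTheory.Balaban1983to89
open B7Prop1Explicit B7Prop2Explicit MatrixNorms
open T4AveragingDeficitWall (IsUnitaryCfg SmallField Ad curlAt curl curlSq)
open T4AveragingDeficitNonAbelian (Ad_mul Ad_sub)
open AveragingDeficitNearIdentity (Ad_one Ad_add norm_Ad_sub_le)
open AveragingDeficitTransport (norm_Ad_of_unitary)
open AveragingDeficitHSInner (nhsNormSq_Ad nhsNorm_Ad_sub_le)
open AveragingDeficitCovGrad (hol_plaqWord_units)
open BlockAveragePushDirGauge (gaugeDir)

noncomputable section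

variable {d : ℕ} {n : Type*} [Fintype n] [DecidableEq n]

/-! ## §1 The identity -/

/-- **THE DRESSED CURL OF A GAUGE DIRECTION IS THE PLAQUETTE COMMUTATOR**: for every units-valued `W` and every site field `ζ`,
`curlAt W (gaugeDir W ζ) z μ ν = ζ z − Ad (hol W z (plaqWord μ ν)) (ζ z)`. [folklore] -/
theorem curlAt_gaugeDir (W : Site d → Fin d → (Matrix n n ℂ)ˣ) (ζ : Site d → Matrix n n ℂ) (z : Site d) (μ ν : Fin d) :
    curlAt W (gaugeDir W ζ) z μ ν = ζ z - Ad (hol W z (plaqWord μ ν)) (ζ z) := by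
  rw [hol_plaqWord_units]
  simp only [curlAt, gaugeDir, Ad_sub, ← Ad_mul, mul_inv_cancel, mul_inv_cancel_right, Ad_one, add_right_comm z (e ν) (e μ)]
  abel

/-- On a degenerate plane `μ = ν` the dressed curl of a gauge direction vanishes. [folklore] -/
theorem curlAt_gaugeDir_self (W : Site d → Fin d → (Matrix n n ℂ)ˣ) (ζ : Site d → Matrix n n ℂ) (z : Site d) (μ : Fin d) :
    curlAt W (gaugeDir W ζ) z μ μ = 0 := by
  rw [curlAt_gaugeDir, hol_plaqWord_units]
  have : W z μ * W (z + e μ) μ * (W (z + e μ) μ)⁻¹ * (W z μ)⁻¹ = 1 := by group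
  rw [this, Ad_one, sub_self]

/-! ## §2 Sizes in the small-field class -/

section Small

variable [Nonempty n] {W : Site d → Fin d → (Matrix n n ℂ)ˣ} (hW : IsUnitaryCfg W) {a : ℝ} (hWa : SmallField W a)
include hW hWa

/-- **OP-NORM SIZE**: `‖curlAt W (gaugeDir W ζ) z μ ν‖ ≤ 2a·‖ζ z‖` on every plane `μ ≠ ν`. [folklore] -/
theorem norm_curlAt_gaugeDir_le (ζ : Site d → Matrix n n ℂ) (z : Site d) {μ ν : Fin d} (hμν : μ ≠ ν) :
    ‖curlAt W (gaugeDir W ζ) z μ ν‖ ≤ 2 * a * ‖ζ z‖ := by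
  rw [curlAt_gaugeDir, ← norm_neg, neg_sub]
  refine (norm_Ad_sub_le (hol_mem_of hW _ _) _).trans ?_
  have h := hWa z μ ν hμν
  have hn : 0 ≤ ‖ζ z‖ := norm_nonneg _
  nlinarith

/-- **NHS SIZE**: `nhsNorm (curlAt W (gaugeDir W ζ) z μ ν) ≤ 2a·nhsNorm (ζ z)` on every plane `μ ≠ ν`. [folklore] -/
theorem nhsNorm_curlAt_gaugeDir_le (ζ : Site d → Matrix n n ℂ) (z : Site d) {μ ν : Fin d} (hμν : μ ≠ ν) :
    nhsNorm (curlAt W (gaugeDir W ζ) z μ ν) ≤ 2 * a * nhsNorm (ζ z) := by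
  have hneg : ∀ X : Matrix n n ℂ, nhsNorm (-X) = nhsNorm X := by
    intro X; simp [nhsNorm, nhsNormSq]
  rw [curlAt_gaugeDir, ← neg_sub, hneg]
  refine (nhsNorm_Ad_sub_le (hol_mem_of hW _ _) _).trans ?_
  have h := hWa z μ ν hμν
  have hn : 0 ≤ nhsNorm (ζ z) := nhsNorm_nonneg _
  nlinarith

/-- … squared: `nhsNormSq (curlAt W (gaugeDir W ζ) z μ ν) ≤ 4a²·nhsNormSq (ζ z)`. [folklore] -/
theorem nhsNormSq_curlAt_gaugeDir_le (ζ : Site d → Matrix n n ℂ) (z : Site d) {μ ν : Fin d} (hμν : μ ≠ ν) :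
    nhsNormSq (curlAt W (gaugeDir W ζ) z μ ν) ≤ 4 * a ^ 2 * nhsNormSq (ζ z) := by
  have h := nhsNorm_curlAt_gaugeDir_le hW hWa ζ z hμν
  have h0 : 0 ≤ nhsNorm (curlAt W (gaugeDir W ζ) z μ ν) := nhsNorm_nonneg _
  rw [← nhsNorm_sq, ← nhsNorm_sq]
  nlinarith [nhsNorm_nonneg (ζ z)]

end Small

/-! ## §3 Linearity of the dressed curl -/

/-- The dressed curl is additive in the direction field. [folklore] -/
theorem curlAt_sub (V : Site d → Fin d → (Matrix n n ℂ)ˣ) (ψ φ : Site d → Fin d → Matrix n n ℂ) (z : Site d) (μ ν : Fin d) :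
    curlAt V (fun x κ => ψ x κ - φ x κ) z μ ν = curlAt V ψ z μ ν - curlAt V φ z μ ν := by
  simp only [curlAt, Ad_sub]
  abel

/-- `‖X − Y‖² ≤ 2‖X‖² + 2‖Y‖²`. [folklore] -/
theorem norm_sub_sq_le (X Y : Matrix n n ℂ) : ‖X - Y‖ ^ 2 ≤ 2 * ‖X‖ ^ 2 + 2 * ‖Y‖ ^ 2 := by
  have h := norm_sub_le X Y
  have h0 : 0 ≤ ‖X - Y‖ := norm_nonneg _
  nlinarith [sq_nonneg (‖X‖ - ‖Y‖), norm_nonneg X, norm_nonneg Y]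

/-! ## §4 The curl energy of a gauge direction and the two-term split -/

/-- **THE CURL ENERGY OF A GAUGE DIRECTION** (unitary `W`, `SmallField W a`): `curlSq W (gaugeDir W ζ) F ≤ 4a²·#(Plane d)·Σ_{z∈F}‖ζ z‖²`.
[folklore] -/
theorem curlSq_gaugeDir_le [Nonempty n] {W : Site d → Fin d → (Matrix n n ℂ)ˣ} (hW : IsUnitaryCfg W) {a : ℝ}
    (hWa : SmallField W a) (ζ : Site d → Matrix n n ℂ) (F : Finset (Site d)) :
    curlSq W (gaugeDir W ζ) F ≤ 4 * a ^ 2 * (Fintype.card (T4AveragingDeficitWall.Plane d)) * ∑ z ∈ F, ‖ζ z‖ ^ 2 := by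
  unfold curlSq
  rw [mul_sum]
  refine sum_le_sum fun z _ => ?_
  have hpt : ∀ π : T4AveragingDeficitWall.Plane d, ‖curl W (gaugeDir W ζ) (z, π)‖ ^ 2 ≤ 4 * a ^ 2 * ‖ζ z‖ ^ 2 := by
    intro π
    have hne : π.1.1 ≠ π.1.2 := ne_of_lt π.2
    have h := norm_curlAt_gaugeDir_le hW hWa ζ z hne
    have h0 : 0 ≤ ‖curlAt W (gaugeDir W ζ) z π.1.1 π.1.2‖ := norm_nonneg _
    show ‖curlAt W (gaugeDir W ζ) z π.1.1 π.1.2‖ ^ 2 ≤ _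
    nlinarith [norm_nonneg (ζ z)]
  calc ∑ π : T4AveragingDeficitWall.Plane d, ‖curl W (gaugeDir W ζ) (z, π)‖ ^ 2
      ≤ ∑ _π : T4AveragingDeficitWall.Plane d, 4 * a ^ 2 * ‖ζ z‖ ^ 2 := sum_le_sum fun π _ => hpt π
    _ = 4 * a ^ 2 * (Fintype.card (T4AveragingDeficitWall.Plane d)) * ‖ζ z‖ ^ 2 := by
        rw [sum_const, card_univ, nsmul_eq_mul]; ring

/-- **THE TWO-TERM SPLIT (S5)**: `curlSq W (Y − gaugeDir W ζ) F ≤ 2·curlSq W Y F + 8a²·#(Plane d)·Σ_{z∈F}‖ζ z‖²` (unitary `W`, `SmallField W a`).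
[folklore] -/
theorem curlSq_sub_gaugeDir_le [Nonempty n] {W : Site d → Fin d → (Matrix n n ℂ)ˣ} (hW : IsUnitaryCfg W) {a : ℝ}
    (hWa : SmallField W a) (Y : Site d → Fin d → Matrix n n ℂ) (ζ : Site d → Matrix n n ℂ) (F : Finset (Site d)) :
    curlSq W (fun x κ => Y x κ - gaugeDir W ζ x κ) F
      ≤ 2 * curlSq W Y F + 8 * a ^ 2 * (Fintype.card (T4AveragingDeficitWall.Plane d)) * ∑ z ∈ F, ‖ζ z‖ ^ 2 := by
  have hg := curlSq_gaugeDir_le hW hWa ζ F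
  have hsplit : curlSq W (fun x κ => Y x κ - gaugeDir W ζ x κ) F ≤ 2 * curlSq W Y F + 2 * curlSq W (gaugeDir W ζ) F := by
    unfold curlSq
    rw [mul_sum, mul_sum, ← sum_add_distrib]
    refine sum_le_sum fun z _ => ?_
    rw [mul_sum, mul_sum, ← sum_add_distrib]
    refine sum_le_sum fun π _ => ?_
    show ‖curlAt W (fun x κ => Y x κ - gaugeDir W ζ x κ) z π.1.1 π.1.2‖ ^ 2
      ≤ 2 * ‖curlAt W Y z π.1.1 π.1.2‖ ^ 2 + 2 * ‖curlAt W (gaugeDir W ζ) z π.1.1 π.1.2‖ ^ 2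
    rw [curlAt_sub]
    exact norm_sub_sq_le _ _
  linarith

end

end Summit.QuantumFields.BalabanUV.T4Continuum.NE3CurlOfGaugeDir
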